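import Summits.BirchSwinnertonDyer.BirchSwinnertonDyer.Theorems.GenusKolyvaginAtTwoPowDvdShaCardAtTwoRTSelmerLadder
import HarnessLib

/-!
# Route `GenusKolyvaginAtTwo`, crux L_T `PowDvdShaCardAtTwoRT` (stmt-BirchSwinnertonDyer-23242), LINE 18 stub 3a⁗ —
# the LINE 18 frame with the supply asked ONLY for avoided sets `s ⊆ R` (the shape the swap oracle delivers)

Seat `bsd-line-gk2-p2` g16 (PROVER seat 2/3, cell `bsd-f1-sign2`), `--supports stmt-BirchSwinnertonDyer-23242` (helper); refinement
of this lineage's `…RTStrictSupply` (p683277) and `…RTSelmerLadder` (p685219/p685276, g15). THEOREMS ONLY. BSD is not proved by this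
file; neither is the crux or the stub.

WHY (ledger `Cruxes/PowDvdShaCardAtTwoRT/Lines/plus-descent-oracle-ledger.md`). The landed frame
`two_mul_sum_le_padicValNat_sha_of_(forall_)relaxed_supply_heegner` asks its one hypothesis `hsupply` — McCallum's Prop. 5.2 over `ℚ`
at `2` — for EVERY finite `s ⊆ H¹(ℚ, E[2^M])`; the oracle side (`exists_avoiding_of_weakSwapOracle`,
`exists_avoiding_of_twoPrimeReciprocity_weak`) delivers it only for `s ⊆ R` (the relaxed Selmer group): the loop's hypothesis `hK`
(index `∣ 2` of the strict condition at a Kolyvagin prime on `⟨s⟩[2]`) needs the avoided classes UNRAMIFIED at the swap primes, i.e.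
in `R` — classes ramified at an own prime localise into a non-cyclic group. The frame's proof only ever feeds `hsupply` with such `s`
(the previous ladder classes and their Cassels–Tate partners lie in `Sel ⊆ R`, the pigeonhole picks lie in `R`), so the mismatch is
only in the statement. This file re-runs the three steps with the hypothesis restricted to `s ⊆ R`:

* §1 `exists_sub_strict_of_relaxed_supply_sub` — the pigeonhole repair with `hsupply` for `s ⊆ R` only (the picks stay in `R`);
* §2 `pow_dvd_natCard_primaryComponent_sha_of_relaxed_selmer_supply_sub` (+ valuation form) — the Selmer-currency ladder under
  `Sel ≤ R`;
* §3 `two_mul_sum_le_padicValNat_sha_of_relaxed_supply_heegner_sub`, `…_of_forall_relaxed_supply_heegner_sub` — THE LINE 18 FRAME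
  with `hsupply` for `s ⊆ R` only; `Sel^{(2^M)}(W/ℚ) ≤ R = res⁻¹ Sel^{(2^M)}(W_K) ⊓ ⨅_∞` by functoriality
  (`resTorsion_mem_selmerGroup`, `mem_selmerGroup_iff`).
So (L₊) for the pen is literally: «∀ large `M`, ∀ `j < k`, ∀ finite `s ⊆ R` with `#s ≤ 2j + (2^{ord₂ C(Wd)} − 1)`, ∃ `z ∈ R` …» —
the output of `exists_avoiding_of_weakSwapOracle_pow` / `exists_avoiding_of_twoPrimeReciprocity_weak`, level by level.

References: [McCallumLMS1991] §5 Prop. 5.2 and p. 310; [Kramer1981] §2 Prop. 3.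
-/

noncomputable section

-- `Summit.<P>.<Sub>` repeats `BirchSwinnertonDyer` by the tree's layout convention (D-0017)
set_option linter.dupNamespace false

open scoped Classical

namespace Summit.BirchSwinnertonDyer.BirchSwinnertonDyer.Theorems.GenusExact.PlusDescent

open _root_.WeierstrassCurve AddSubgroup NumberField Literature.NumberTheory.EllipticCurves
open Literature.GroupTheory.FiniteAbelian
open Summit.BirchSwinnertonDyer.BirchSwinnertonDyer.Theorems.GenusExact.CasselsTateNumberField

/-! ## §1 Pigeonhole repair with the supply restricted to `s ⊆ R` -/

section Repair

variable {A Q : Type*} [AddCommGroup A] [AddCommGroup Q]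

/-- **Strict supply from relaxed supply, `s ⊆ R` form.** As `exists_sub_strict_of_relaxed_supply`, but the relaxed supply is asked
only for finite `s ⊆ R` (`#s ≤ B`), and the conclusion is for `s₀ ⊆ R` with `#s₀ + #(F ∖ {0}) ≤ B`: the picks of the pigeonhole are
themselves in `R`, so every set ever fed to the supply lies in `R`. [folklore] -/
theorem exists_sub_strict_of_relaxed_supply_sub [DecidableEq Q] (R : AddSubgroup A) (π : A →+ Q) (F : Finset Q)
    (m B : ℕ)
    (hsupply : ∀ s : Finset A, (↑s : Set A) ⊆ R → s.card ≤ B →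
      ∃ z ∈ R, m ∣ addOrderOf z ∧ π z ∈ F ∧ Disjoint (zmultiples z) (closure (s : Set A)))
    (s₀ : Finset A) (hs₀R : (↑s₀ : Set A) ⊆ R) (hB : s₀.card + (F.erase 0).card ≤ B) :
    ∃ z ∈ R, m ∣ addOrderOf z ∧ π z = 0 ∧ Disjoint (zmultiples z) (closure (s₀ : Set A)) := by
  classical
  -- invariant as in `exists_sub_strict_of_relaxed_supply`, plus `s ⊆ R`
  suffices key : ∀ (n : ℕ) (s : Finset A) (G : Finset Q), G ⊆ F.erase 0 → G.card + n = (F.erase 0).card →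
      s₀ ⊆ s → (↑s : Set A) ⊆ R → s.card ≤ s₀.card + G.card →
      (∀ g ∈ G, ∃ w ∈ s, w ∈ R ∧ π w = g ∧ Disjoint (zmultiples w) (closure (s₀ : Set A))) →
      ∃ z ∈ R, m ∣ addOrderOf z ∧ π z = 0 ∧ Disjoint (zmultiples z) (closure (s₀ : Set A)) from
    key (F.erase 0).card s₀ ∅ (Finset.empty_subset _) (by simp) subset_rfl hs₀R (by simp) (by simp)
  intro n
  induction n with
  | zero =>
    intro s G hGF hGc hs₀ hsR hsc hG
    obtain ⟨z, hzR, hm, hzF, hz⟩ := hsupply s hsR (by omega)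
    by_cases h0 : π z = 0
    · exact ⟨z, hzR, hm, h0, hz.mono_right (closure_mono (Finset.coe_subset.mpr hs₀))⟩
    · have hGeq : G = F.erase 0 := Finset.eq_of_subset_of_card_le hGF (by omega)
      have hzG : π z ∈ G := by rw [hGeq]; exact Finset.mem_erase.mpr ⟨h0, hzF⟩
      obtain ⟨w, hws, hwR, hπw, hw⟩ := hG _ hzG
      obtain ⟨hdvd, hdisj⟩ := addOrderOf_dvd_and_disjoint_zmultiples_sub hs₀ hws hz hw
      exact ⟨z - w, R.sub_mem hzR hwR, hm.trans hdvd, by rw [map_sub, hπw, sub_self], hdisj⟩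
  | succ n ih =>
    intro s G hGF hGc hs₀ hsR hsc hG
    obtain ⟨z, hzR, hm, hzF, hz⟩ := hsupply s hsR (by omega)
    by_cases h0 : π z = 0
    · exact ⟨z, hzR, hm, h0, hz.mono_right (closure_mono (Finset.coe_subset.mpr hs₀))⟩
    by_cases hzG : π z ∈ G
    · obtain ⟨w, hws, hwR, hπw, hw⟩ := hG _ hzG
      obtain ⟨hdvd, hdisj⟩ := addOrderOf_dvd_and_disjoint_zmultiples_sub hs₀ hws hz hw
      exact ⟨z - w, R.sub_mem hzR hwR, hm.trans hdvd, by rw [map_sub, hπw, sub_self], hdisj⟩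
    · -- a new image: record it and recurse (the pick `z` is in `R`, so `insert z s ⊆ R`)
      have hzs : z ∉ s := fun hzs ↦ by
        have h1 : z ∈ zmultiples z ⊓ closure (s : Set A) :=
          AddSubgroup.mem_inf.mpr ⟨mem_zmultiples z, subset_closure (Finset.mem_coe.mpr hzs)⟩
        rw [hz.eq_bot, AddSubgroup.mem_bot] at h1
        exact h0 (by rw [h1, map_zero])
      refine ih (insert z s) (insert (π z) G) ?_ ?_ (hs₀.trans (Finset.subset_insert z s)) ?_ ?_ ?_
      · exact Finset.insert_subset (Finset.mem_erase.mpr ⟨h0, hzF⟩) hGF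
      · rw [Finset.card_insert_of_notMem hzG]; omega
      · rw [Finset.coe_insert]
        exact Set.insert_subset hzR hsR
      · rw [Finset.card_insert_of_notMem hzs, Finset.card_insert_of_notMem hzG]; omega
      · intro g hg
        rcases Finset.mem_insert.mp hg with rfl | hg
        · exact ⟨z, Finset.mem_insert_self z s, hzR, rfl,
            hz.mono_right (closure_mono (Finset.coe_subset.mpr hs₀))⟩
        · obtain ⟨w, hws, hwR, hπw, hw⟩ := hG g hg
          exact ⟨w, Finset.mem_insert_of_mem hws, hwR, hπw, hw⟩

end Repair

/-! ## §2 The Selmer-currency ladder with the supply restricted to `s ⊆ R` -/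

section Dictionary

variable {K : Type} [Field K] [NumberField K] (V : WeierstrassCurve K) [V.IsElliptic] (p : ℕ) [hp : Fact p.Prime]

/-- **Loss-free Selmer ladder from a RELAXED supply asked only on `s ⊆ R`.** As
`pow_dvd_natCard_primaryComponent_sha_of_relaxed_selmer_supply`, with `hsupply` restricted to finite `s ⊆ R` and the extra (always
available) hypothesis `Sel^{(p^M)} ≤ R`: the avoided sets of the ladder lie in `Sel`, the pigeonhole picks in `R`.
[cite: McCallumLMS1991, §5 Prop. 5.2 and p. 310] -/
theorem pow_dvd_natCard_primaryComponent_sha_of_relaxed_selmer_supply_sub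
    [Finite (AddCommGroup.primaryComponent V.sha p)] (M : ℕ)
    (hdivK : ∀ P : V.toAffine.Point, ∃ Q : V.toAffine.Point, ((p ^ M : ℕ) : ℤ) • Q = P)
    (hexp : ∀ y : AddCommGroup.primaryComponent V.sha p, p ^ M • y = 0)
    (R : AddSubgroup (galH1Torsion V ((p ^ M : ℕ) : ℤ))) (hSR : selmerGroup V ((p ^ M : ℕ) : ℤ) ≤ R) {h : ℕ}
    (hidx : (selmerGroup V ((p ^ M : ℕ) : ℤ)).relIndex R ≤ h)
    (hidx0 : (selmerGroup V ((p ^ M : ℕ) : ℤ)).relIndex R ≠ 0) (k : ℕ) (a : ℕ → ℕ)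
    (hsupply : ∀ j < k, ∀ s : Finset (galH1Torsion V ((p ^ M : ℕ) : ℤ)),
      (↑s : Set (galH1Torsion V ((p ^ M : ℕ) : ℤ))) ⊆ R → s.card ≤ 2 * j + (h - 1) →
      ∃ z ∈ R, p ^ a j ∣ addOrderOf z ∧
        Disjoint (zmultiples z) (closure (s : Set (galH1Torsion V ((p ^ M : ℕ) : ℤ))))) :
    p ^ (2 * ∑ j ∈ Finset.range k, a j) ∣ Nat.card (AddCommGroup.primaryComponent V.sha p) := by
  classical
  set S : AddSubgroup (galH1Torsion V ((p ^ M : ℕ) : ℤ)) := selmerGroup V ((p ^ M : ℕ) : ℤ) with hS_def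
  set π : galH1Torsion V ((p ^ M : ℕ) : ℤ) →+ galH1Torsion V ((p ^ M : ℕ) : ℤ) ⧸ S := QuotientAddGroup.mk' S
    with hπ_def
  -- the defect set `F = π(R) = R/Sel`, of `[R : Sel]` elements
  have hcardI : Nat.card (R.map π) = S.relIndex R := natCard_map_mk'_eq_relIndex S R
  haveI hfinI : Finite (R.map π) := Nat.finite_of_card_ne_zero (hcardI ▸ hidx0)
  have hIfin : ((R.map π : AddSubgroup _) : Set (galH1Torsion V ((p ^ M : ℕ) : ℤ) ⧸ S)).Finite :=
    Set.toFinite _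
  set F : Finset (galH1Torsion V ((p ^ M : ℕ) : ℤ) ⧸ S) := hIfin.toFinset with hF_def
  have hmemF : ∀ z ∈ R, π z ∈ F := fun z hz ↦ by
    rw [hF_def, Set.Finite.mem_toFinset]
    exact AddSubgroup.mem_map_of_mem π hz
  have hFcard : F.card = S.relIndex R := by
    rw [← hcardI]
    exact (Nat.card_eq_card_finite_toFinset hIfin).symm
  have h0F : (0 : galH1Torsion V ((p ^ M : ℕ) : ℤ) ⧸ S) ∈ F := by
    rw [← map_zero π]; exact hmemF 0 R.zero_mem
  have hFerase : (F.erase 0).card ≤ h - 1 := by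
    rw [Finset.card_erase_of_mem h0F, hFcard]
    exact Nat.sub_le_sub_right hidx 1
  -- strict supply by the pigeonhole repair (restricted form), then the Selmer avoidance ladder
  refine pow_dvd_natCard_primaryComponent_sha_of_selmer_avoidance V p M hdivK hexp k a fun j hj s hsS hcard ↦ ?_
  have hsup' : ∀ s' : Finset (galH1Torsion V ((p ^ M : ℕ) : ℤ)),
      (↑s' : Set (galH1Torsion V ((p ^ M : ℕ) : ℤ))) ⊆ (R : Set (galH1Torsion V ((p ^ M : ℕ) : ℤ))) →
      s'.card ≤ 2 * j + (F.erase 0).card →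
      ∃ z ∈ R, p ^ a j ∣ addOrderOf z ∧ π z ∈ F ∧
        Disjoint (zmultiples z) (closure (s' : Set (galH1Torsion V ((p ^ M : ℕ) : ℤ)))) := by
    intro s' hs'R hs'
    obtain ⟨z, hzR, hdvd, hdisj⟩ := hsupply j hj s' hs'R (by omega)
    exact ⟨z, hzR, hdvd, hmemF z hzR, hdisj⟩
  obtain ⟨z, -, hdvd, hπz, hdisj⟩ :=
    exists_sub_strict_of_relaxed_supply_sub R π F (p ^ a j) (2 * j + (F.erase 0).card) hsup' s
      (hsS.trans fun x hx ↦ hSR hx) (by omega)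
  refine ⟨z, ?_, hdvd, hdisj⟩
  rw [hπ_def, QuotientAddGroup.mk'_apply, QuotientAddGroup.eq_zero_iff] at hπz
  exact hπz

/-- The same in valuation form: `2(a₀ + ⋯ + a_{k-1}) ≤ ord_p #Ш(E/K)[p^∞]`. [cite: McCallumLMS1991, §5 Prop. 5.2 and p. 310] -/
theorem two_mul_sum_le_padicValNat_natCard_primaryComponent_sha_of_relaxed_selmer_supply_sub
    [Finite (AddCommGroup.primaryComponent V.sha p)] (M : ℕ)
    (hdivK : ∀ P : V.toAffine.Point, ∃ Q : V.toAffine.Point, ((p ^ M : ℕ) : ℤ) • Q = P)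
    (hexp : ∀ y : AddCommGroup.primaryComponent V.sha p, p ^ M • y = 0)
    (R : AddSubgroup (galH1Torsion V ((p ^ M : ℕ) : ℤ))) (hSR : selmerGroup V ((p ^ M : ℕ) : ℤ) ≤ R) {h : ℕ}
    (hidx : (selmerGroup V ((p ^ M : ℕ) : ℤ)).relIndex R ≤ h)
    (hidx0 : (selmerGroup V ((p ^ M : ℕ) : ℤ)).relIndex R ≠ 0) (k : ℕ) (a : ℕ → ℕ)
    (hsupply : ∀ j < k, ∀ s : Finset (galH1Torsion V ((p ^ M : ℕ) : ℤ)),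
      (↑s : Set (galH1Torsion V ((p ^ M : ℕ) : ℤ))) ⊆ R → s.card ≤ 2 * j + (h - 1) →
      ∃ z ∈ R, p ^ a j ∣ addOrderOf z ∧
        Disjoint (zmultiples z) (closure (s : Set (galH1Torsion V ((p ^ M : ℕ) : ℤ))))) :
    2 * ∑ j ∈ Finset.range k, a j ≤ padicValNat p (Nat.card (AddCommGroup.primaryComponent V.sha p)) := by
  rw [← padicValNat_dvd_iff_le (Nat.card_pos (α := AddCommGroup.primaryComponent V.sha p)).ne']
  exact pow_dvd_natCard_primaryComponent_sha_of_relaxed_selmer_supply_sub V p M hdivK hexp R hSR hidx hidx0 k a hsupply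

end Dictionary

/-! ## §3 The LINE 18 frame with the supply restricted to `s ⊆ R` -/

section Frame

variable (W : WeierstrassCurve ℚ) [W.IsElliptic] [W.IsGloballyMinimal] {K : Type} [Field K] [NumberField K]

omit [W.IsElliptic] [W.IsGloballyMinimal] in
/-- `Sel^{(n)}(E/ℚ) ≤ res⁻¹ Sel^{(n)}(E_K/K) ⊓ ⨅_∞`: the `d_K`-relaxed Selmer group contains the Selmer group (functoriality of
Selmer groups under base change, and the Selmer condition at the infinite place). [folklore] -/
theorem selmerGroup_le_comap_resTorsion_inf_iInf (n : ℤ) :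
    selmerGroup W n ≤ (selmerGroup (W.baseChange K) n).comap (resTorsion W K n) ⊓
      ⨅ w : InfinitePlace ℚ, selmerLocalKer W w.Completion n := by
  intro x hx
  refine AddSubgroup.mem_inf.mpr ⟨?_, ?_⟩
  · exact AddSubgroup.mem_comap.mpr (resTorsion_mem_selmerGroup W K n hx)
  · rw [AddSubgroup.mem_iInf]
    exact fun w ↦ ((mem_selmerGroup_iff W n x).mp hx).2 w

/-- **RANK-ZERO SIDE OF 3a⁗, ALL RUNGS — the supply asked only on `s ⊆ R`.** As
`two_mul_sum_le_padicValNat_sha_of_relaxed_supply_heegner` (g15), with `hsupply` restricted to finite sets of classes INSIDE the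
relaxed Selmer group `R = res⁻¹ Sel^{(2^M)}(W_K) ⊓ ⨅_∞` — the shape delivered by `exists_avoiding_of_weakSwapOracle_pow` /
`exists_avoiding_of_twoPrimeReciprocity_weak`. [cite: McCallumLMS1991, §5 Prop. 5.2 and p. 310] [cite: Kramer1981, §2 Prop. 3] -/
theorem two_mul_sum_le_padicValNat_sha_of_relaxed_supply_heegner_sub (hK : IsImaginaryQuadratic K)
    (hodd : Odd (NumberField.discr K)) (hH : SatisfiesHeegnerHypothesis (W.conductorNorm ℤ) K)
    (hT : Odd W.tamagawaProduct) {Wd : WeierstrassCurve ℚ} [Wd.IsElliptic] (Cd : VariableChange ℚ)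
    (hWd : Cd • W.quadraticTwist (NumberField.discr K : ℚ) = Wd)
    (hrk : W.mordellWeilRank = 0) (htor : Odd W.torsionOrder)
    [Finite (AddCommGroup.primaryComponent W.sha 2)] (M : ℕ)
    (hexp : ∀ y : AddCommGroup.primaryComponent W.sha 2, 2 ^ M • y = 0)
    (hm0 : (selmerGroup W ((2 ^ M : ℕ) : ℤ)).relIndex
      ((selmerGroup (W.baseChange K) ((2 ^ M : ℕ) : ℤ)).comap (resTorsion W K ((2 ^ M : ℕ) : ℤ)) ⊓
        ⨅ w : InfinitePlace ℚ, selmerLocalKer W w.Completion ((2 ^ M : ℕ) : ℤ)) ≠ 0)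
    (k : ℕ) (a : ℕ → ℕ)
    (hsupply : ∀ j < k, ∀ s : Finset (galH1Torsion W ((2 ^ M : ℕ) : ℤ)),
      (↑s : Set (galH1Torsion W ((2 ^ M : ℕ) : ℤ))) ⊆
        (((selmerGroup (W.baseChange K) ((2 ^ M : ℕ) : ℤ)).comap (resTorsion W K ((2 ^ M : ℕ) : ℤ)) ⊓
          ⨅ w : InfinitePlace ℚ, selmerLocalKer W w.Completion ((2 ^ M : ℕ) : ℤ) :
            AddSubgroup (galH1Torsion W ((2 ^ M : ℕ) : ℤ))) : Set (galH1Torsion W ((2 ^ M : ℕ) : ℤ))) →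
      s.card ≤ 2 * j + (2 ^ padicValNat 2 Wd.tamagawaProduct - 1) →
      ∃ z ∈ (selmerGroup (W.baseChange K) ((2 ^ M : ℕ) : ℤ)).comap (resTorsion W K ((2 ^ M : ℕ) : ℤ)) ⊓
          ⨅ w : InfinitePlace ℚ, selmerLocalKer W w.Completion ((2 ^ M : ℕ) : ℤ),
        2 ^ a j ∣ addOrderOf z ∧
        Disjoint (zmultiples z) (closure (s : Set (galH1Torsion W ((2 ^ M : ℕ) : ℤ))))) :
    2 * ∑ j ∈ Finset.range k, a j ≤ padicValNat 2 (Nat.card (AddCommGroup.primaryComponent W.sha 2)) := by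
  haveI : Fact (Nat.Prime 2) := ⟨Nat.prime_two⟩
  exact two_mul_sum_le_padicValNat_natCard_primaryComponent_sha_of_relaxed_selmer_supply_sub W 2 M
    (exists_zsmul_two_pow_eq_of_rank_zero_of_odd_torsionOrder W hrk htor M) hexp _
    (selmerGroup_le_comap_resTorsion_inf_iInf W _)
    (relIndex_selmerGroup_relaxed_le_two_pow_padicValNat_tamagawaProduct_twin W hK hodd hH hT Cd hWd _) hm0 k a
    hsupply

/-- **The frame at EVERY large level, supply on `s ⊆ R`**: as `two_mul_sum_le_padicValNat_sha_of_forall_relaxed_supply_heegner`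
with the restricted `hsupply` — exactly (L₊) in the shape the oracle delivers. [cite: McCallumLMS1991, §5 Prop. 5.2 and p. 310] -/
theorem two_mul_sum_le_padicValNat_sha_of_forall_relaxed_supply_heegner_sub (hK : IsImaginaryQuadratic K)
    (hodd : Odd (NumberField.discr K)) (hH : SatisfiesHeegnerHypothesis (W.conductorNorm ℤ) K)
    (hT : Odd W.tamagawaProduct) {Wd : WeierstrassCurve ℚ} [Wd.IsElliptic] (Cd : VariableChange ℚ)
    (hWd : Cd • W.quadraticTwist (NumberField.discr K : ℚ) = Wd)
    (hrk : W.mordellWeilRank = 0) (htor : Odd W.torsionOrder)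
    [Finite (AddCommGroup.primaryComponent W.sha 2)]
    (hm0 : ∀ M : ℕ, (selmerGroup W ((2 ^ M : ℕ) : ℤ)).relIndex
      ((selmerGroup (W.baseChange K) ((2 ^ M : ℕ) : ℤ)).comap (resTorsion W K ((2 ^ M : ℕ) : ℤ)) ⊓
        ⨅ w : InfinitePlace ℚ, selmerLocalKer W w.Completion ((2 ^ M : ℕ) : ℤ)) ≠ 0)
    (M₁ k : ℕ) (a : ℕ → ℕ)
    (hsupply : ∀ M : ℕ, M₁ ≤ M → ∀ j < k, ∀ s : Finset (galH1Torsion W ((2 ^ M : ℕ) : ℤ)),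
      (↑s : Set (galH1Torsion W ((2 ^ M : ℕ) : ℤ))) ⊆
        (((selmerGroup (W.baseChange K) ((2 ^ M : ℕ) : ℤ)).comap (resTorsion W K ((2 ^ M : ℕ) : ℤ)) ⊓
          ⨅ w : InfinitePlace ℚ, selmerLocalKer W w.Completion ((2 ^ M : ℕ) : ℤ) :
            AddSubgroup (galH1Torsion W ((2 ^ M : ℕ) : ℤ))) : Set (galH1Torsion W ((2 ^ M : ℕ) : ℤ))) →
      s.card ≤ 2 * j + (2 ^ padicValNat 2 Wd.tamagawaProduct - 1) →
      ∃ z ∈ (selmerGroup (W.baseChange K) ((2 ^ M : ℕ) : ℤ)).comap (resTorsion W K ((2 ^ M : ℕ) : ℤ)) ⊓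
          ⨅ w : InfinitePlace ℚ, selmerLocalKer W w.Completion ((2 ^ M : ℕ) : ℤ),
        2 ^ a j ∣ addOrderOf z ∧
        Disjoint (zmultiples z) (closure (s : Set (galH1Torsion W ((2 ^ M : ℕ) : ℤ))))) :
    2 * ∑ j ∈ Finset.range k, a j ≤ padicValNat 2 (Nat.card (AddCommGroup.primaryComponent W.sha 2)) := by
  haveI : Fact (Nat.Prime 2) := ⟨Nat.prime_two⟩
  set M : ℕ := max M₁ (Nat.card (AddCommGroup.primaryComponent W.sha 2)) with hM_def
  exact two_mul_sum_le_padicValNat_sha_of_relaxed_supply_heegner_sub W hK hodd hH hT Cd hWd hrk htor M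
    (pow_nsmul_eq_zero_primaryComponent_sha_of_le W 2 (le_max_right _ _)) (hm0 M) k a
    (hsupply M (le_max_left _ _))

end Frame

end Summit.BirchSwinnertonDyer.BirchSwinnertonDyer.Theorems.GenusExact.PlusDescent

end
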